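import Summits.FinalStateConjecture.FinalStateConjecture.Theorems.KerrShieldedDataExist.Negative.SliceClause
import Summits.FinalStateConjecture.FinalStateConjecture.Theorems.KerrShieldedDataExist.Negative.BentSlopeBounds
import Summits.FinalStateConjecture.FinalStateConjecture.Theorems.KerrShieldedDataExist.Negative.BentHeightSmooth
import Summits.FinalStateConjecture.FinalStateConjecture.Theorems.EIHFluxBalanceInertialRecessionCalculus
import Literature.Geometry.Lorentzian.KerrSchildDerivativeDecay
import Literature.Geometry.Lorentzian.KerrSchildCoord
import Literature.Geometry.Lorentzian.KerrWaveEnergy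

/-!
# Crux `HonestFixedRadiusSettling` · line `sojourn-needs-only-one-over-delta` · stub `stub_farExit`
# Layer H1 (a): calculus of the exact end — the chart map `toKS` and the exact components `gBL`

Helper file for `stmt-FinalStateConjecture-13550` (stub `stub_farExit`, exact-Kerr transport of far
null rays). The registered stub binds three `let`s: the bent Boyer–Lindquist height
`blH M a = bentHeight M a` (route SwallowTheDatum's hard-coded `T_{M,a}`,
`Theorems/KerrShieldedDataExist/Negative/BentHeight.lean`, definitionally), the chart map
`toKS M a y = (y⁰ + T_{M,a}(r(a, y⃗)), y⃗)` from Boyer–Lindquist-type time over Kerr–Schild space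
into the ingoing Kerr–Schild chart, and the exact components
`gBL M a y = (toKS)^* g_{M,a} = g_{M,a}(toKS y)(D toKS_y ·, D toKS_y ·)`, `g_{M,a} = η + 2H ℓ ⊗ ℓ`
the Kerr–Schild form (`Kerr.bilin`).

This file is the pure `E4` calculus of these objects, written for an ARBITRARY height
`h : E3 → ℝ` (the lemmas take the maps `S y = y + h(y⃗) e₀` and
`G y = g_{M,a}(S y)(DS_y ·, DS_y ·)` as hypotheses-by-equation, so that the stub's `let`s
instantiate them by `rfl`):
* `toKS` is the shear `y ↦ y + h(y⃗) e₀` with `h = bentHeightFun M a` (`toKS_eq_add_smul`); its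
  differential is `DS = id + (dh ∘ spatial) ⊗ e₀` (`hasFDerivAt_shear`), which fixes `e₀`, keeps
  spatial parts, and is inverted by `id − (dh ∘ spatial) ⊗ e₀`;
* `G y (u, v) = g_{M,a}(y)(DS u, DS v)` (stationarity of the Kerr–Schild components under the
  time shift `S y − y ∈ ℝ e₀`, `Kerr.bilin_add_smul_basisVector_zero`), `G` is symmetric,
  stationary (`G (y + t e₀) = G y`, hence `∂₀ G = 0`), smooth and nondegenerate wherever `r > 0`
  and `h` is smooth, and `G(e₀, e₀) = −1 + 2H < 0` far out;
* the junk cases of the `let`s: for `0 ≤ M ≤ |a|` (extremal spin or `M = 0`) one has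
  `M/√(M² − a²) = 0`, so `bentHeight M a ≡ 0` (`bentHeight_eq_zero_of_le_abs`) and `toKS = id`;
  in all cases `0 ≤ M`, `|a| ≤ M` the height is `C^∞` and, at Kerr–Schild radius `r > 8M`,
  `‖d(bentHeightFun)‖ ≤ (2M/(r − 2M)) (1 + |a|/r)` (`norm_fderiv_bentHeightFun_le`);
* the far-zone numerics at spatial radius `‖y⃗‖ ≥ 16M + |a| + 1`: `r ≥ 16M + 1`, `H ≤ 1/16`,
  `(2M/(r − 2M))(1 + |a|/r) ≤ 1/6` (`far_numerics`).

References: R. P. Kerr, A. Schild (1965), §2–§3; M. Visser, arXiv:0706.0622, (32)–(35);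
M. Dafermos, I. Rodnianski, arXiv:0811.0354, §5.1 (Kerr-star / Boyer–Lindquist heights);
B. O'Neill, *Semi-Riemannian geometry* (1983), Ch. 3.
-/

set_option linter.dupNamespace false

noncomputable section

open Literature.Geometry.Lorentzian
open scoped Manifold ContDiff Topology
open Filter Set

namespace Summit.FinalStateConjecture.FinalStateConjecture.Theorems.StarvedNecks.OneOverDelta.FarEnd

open Summit.FinalStateConjecture.FinalStateConjecture.Theorems.KerrShieldedDataExist.Negative

/-! ## The bent height in all cases `0 ≤ M`, `|a| ≤ M` -/

section Height

variable {M a : ℝ}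

/-- **Junk cases of the hard-coded height.** For `0 ≤ M ≤ |a|` (extremal spin, or `M = 0`) the
prefactor `M/√(M² − a²) = M/0` is Lean's `0`, so `bentHeight M a ≡ 0`. [folklore] -/
theorem bentHeight_eq_zero_of_le_abs (hM : 0 ≤ M) (h : M ≤ |a|) : bentHeight M a = fun _ ↦ 0 := by
  have hsq : Real.sqrt (M ^ 2 - a ^ 2) = 0 :=
    Real.sqrt_eq_zero'.2 (by nlinarith [sq_abs a, abs_nonneg a])
  funext r
  simp [bentHeight, blHeight, hsq]

/-- The hard-coded height is `C^∞` for all admissible parameters `0 ≤ M`, `|a| ≤ M` (sub-extremal: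
`contDiff_bentHeight`; otherwise it vanishes identically). [folklore] -/
theorem contDiff_bentHeight_of_abs_le (hM : 0 ≤ M) (ha : |a| ≤ M) {n : ℕ∞} :
    ContDiff ℝ n (bentHeight M a) := by
  rcases lt_or_eq_of_le ha with h | h
  · exact contDiff_bentHeight h
  · rw [bentHeight_eq_zero_of_le_abs hM h.ge]
    exact contDiff_const

/-- The height function `h(x) = T_{M,a}(r(a, (0, x)))` on Kerr–Schild space is `C^∞` wherever the
Kerr–Schild radius is positive. [folklore] -/
theorem contDiffAt_bentHeightFun_of_abs_le (hM : 0 ≤ M) (ha : |a| ≤ M) {x : E3}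
    (hr : 0 < Kerr.radius a (E4.ofTimeSpace 0 x)) {n : ℕ∞} :
    ContDiffAt ℝ n (bentHeightFun M a) x :=
  (contDiff_bentHeight_of_abs_le hM ha).contDiffAt.comp x (Kerr.contDiffAt_radius_slice hr)

/-- **Slope bound of the height function** beyond `8M`: `‖dh_x‖ ≤ (2M/(r − 2M)) (1 + |a|/r)`,
`r = r(a, (0, x)) > 8M` (sub-extremal: `dh = T′(r) dr`, `T′ = 2Mr/Δ ≤ 2M/(r − 2M)`,
`‖dr‖ ≤ 1 + |a|/r`; junk cases: `dh = 0`). [folklore] -/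
theorem norm_fderiv_bentHeightFun_le (hM : 0 ≤ M) (ha : |a| ≤ M) {x : E3}
    (hr8 : 8 * M < Kerr.radius a (E4.ofTimeSpace 0 x)) (hr0 : 0 < Kerr.radius a (E4.ofTimeSpace 0 x)) :
    ‖fderiv ℝ (bentHeightFun M a) x‖ ≤
      2 * M / (Kerr.radius a (E4.ofTimeSpace 0 x) - 2 * M) *
        (1 + |a| / Kerr.radius a (E4.ofTimeSpace 0 x)) := by
  set r := Kerr.radius a (E4.ofTimeSpace 0 x) with hr_def
  have hr2 : 0 < r - 2 * M := by linarith
  have hbound : 0 ≤ 2 * M / (r - 2 * M) * (1 + |a| / r) := by positivity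
  rcases lt_or_eq_of_le ha with h | h
  · have hMpos : 0 < M := (abs_nonneg a).trans_lt h
    rw [fderiv_bentHeightFun h hr0, norm_smul, bentSlope_eq_of_ge hMpos hr8.le, Real.norm_eq_abs]
    have hrp : Kerr.rPlus M a < r := by linarith [rPlus_le_two_mul h]
    have h1 : |2 * M * r / (r ^ 2 - 2 * M * r + a ^ 2)| ≤ 2 * M / (r - 2 * M) := by
      rw [abs_of_nonneg (div_nonneg (by positivity) (delta_pos h hrp).le)]
      exact blSlope_le h (by linarith)
    exact mul_le_mul h1 (Kerr.norm_radiusGrad_le_radius hr0) (norm_nonneg _) (by positivity)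
  · have h0 : bentHeightFun M a = fun _ ↦ 0 := by
      funext y
      simp [bentHeightFun, bentHeight_eq_zero_of_le_abs hM h.ge]
    rw [h0, fderiv_const_apply, norm_zero]
    exact hbound

end Height

/-! ## The shear `S y = y + h(y⃗) e₀` and its differential -/

section Shear

/-- The stub's `toKS M a`, literally `y ↦ (y⁰ + T_{M,a}(r(a, (0, y⃗))), y⃗)`, is the shear
`y ↦ y + h(y⃗) e₀` with `h = bentHeightFun M a`. [folklore] -/
theorem toKS_eq_add_smul (M a : ℝ) (y : E4) :
    E4.ofTimeSpace (y 0 + bentHeight M a (Kerr.radius a (E4.ofTimeSpace 0 (E4.spatial y))))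
        (E4.spatial y) = y + bentHeightFun M a (E4.spatial y) • E4.basisVector 0 := by
  ext i
  refine Fin.cases ?_ (fun j ↦ ?_) i
  · simp [bentHeightFun]
  · simp [Fin.succ_ne_zero]

/-- **Differential of the shear**: if `h` has differential `h'` at `y⃗` then `S y = y + h(y⃗) e₀`
has differential `DS_y = id + (h' ∘ spatial) ⊗ e₀` at `y`. [folklore] -/
theorem hasFDerivAt_shear {h : E3 → ℝ} {h' : E3 →L[ℝ] ℝ} {y : E4} (hh : HasFDerivAt h h' (E4.spatial y)) :
    HasFDerivAt (fun y : E4 ↦ y + h (E4.spatial y) • E4.basisVector 0)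
      (ContinuousLinearMap.id ℝ E4 + (h'.comp E4.spatial).smulRight (E4.basisVector 0)) y :=
  (hasFDerivAt_id y).add ((hh.comp y E4.spatial.hasFDerivAt).smul_const (E4.basisVector 0))

/-- The value of the sheared differential: `DS u = u + ℓ(u) e₀` for `ℓ = h' ∘ spatial`. [folklore] -/
theorem shearCLM_apply (ℓ : E4 →L[ℝ] ℝ) (u : E4) :
    (ContinuousLinearMap.id ℝ E4 + ℓ.smulRight (E4.basisVector 0)) u = u + ℓ u • E4.basisVector 0 := by
  simp

/-- The time component of `DS u` is `u⁰ + ℓ(u)`. [folklore] -/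
theorem shearCLM_apply_zero (ℓ : E4 →L[ℝ] ℝ) (u : E4) :
    (ContinuousLinearMap.id ℝ E4 + ℓ.smulRight (E4.basisVector 0)) u 0 = u 0 + ℓ u := by
  simp

/-- The spatial part of `DS u` is that of `u`. [folklore] -/
theorem spatial_shearCLM_apply (ℓ : E4 →L[ℝ] ℝ) (u : E4) :
    E4.spatial ((ContinuousLinearMap.id ℝ E4 + ℓ.smulRight (E4.basisVector 0)) u) = E4.spatial u := by
  rw [shearCLM_apply, Kerr.spatial_add_smul_basisVector_zero]

/-- A sheared differential with `ℓ(e₀) = 0` fixes `e₀`. [folklore] -/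
theorem shearCLM_basisVector_zero {ℓ : E4 →L[ℝ] ℝ} (hℓ : ℓ (E4.basisVector 0) = 0) :
    (ContinuousLinearMap.id ℝ E4 + ℓ.smulRight (E4.basisVector 0)) (E4.basisVector 0) =
      E4.basisVector 0 := by
  rw [shearCLM_apply, hℓ, zero_smul, add_zero]

/-- A functional of the form `h' ∘ spatial` kills `e₀`. [folklore] -/
theorem comp_spatial_basisVector_zero (h' : E3 →L[ℝ] ℝ) : (h'.comp E4.spatial) (E4.basisVector 0) = 0 := by
  rw [ContinuousLinearMap.comp_apply, E4.spatial_basisVector_zero, map_zero]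

/-- A sheared differential with `ℓ(e₀) = 0` is injective: `u + ℓ(u) e₀ = 0` forces `ℓ(u) = 0`
(apply `ℓ`) and then `u = 0`. [folklore] -/
theorem shearCLM_injective {ℓ : E4 →L[ℝ] ℝ} (hℓ : ℓ (E4.basisVector 0) = 0) :
    Function.Injective (ContinuousLinearMap.id ℝ E4 + ℓ.smulRight (E4.basisVector 0)) := by
  refine (injective_iff_map_eq_zero _).2 fun u hu ↦ ?_
  rw [shearCLM_apply] at hu
  have h1 : ℓ u = 0 := by
    have := congrArg ℓ hu
    rwa [map_add, map_smul, hℓ, smul_zero, add_zero, map_zero] at this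
  rwa [h1, zero_smul, add_zero] at hu

/-- A sheared differential with `ℓ(e₀) = 0` is surjective: `v = DS (v − ℓ(v) e₀)`. [folklore] -/
theorem shearCLM_surjective {ℓ : E4 →L[ℝ] ℝ} (hℓ : ℓ (E4.basisVector 0) = 0) :
    Function.Surjective (ContinuousLinearMap.id ℝ E4 + ℓ.smulRight (E4.basisVector 0)) := by
  intro v
  refine ⟨v - ℓ v • E4.basisVector 0, ?_⟩
  rw [shearCLM_apply, map_sub, map_smul, hℓ, smul_eq_mul, mul_zero, sub_zero, sub_add_cancel]

/-- The bound `|ℓ(u)| ≤ θ ‖u⃗‖` for `ℓ = h' ∘ spatial` with `‖h'‖ ≤ θ`. [folklore] -/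
theorem abs_comp_spatial_le {h' : E3 →L[ℝ] ℝ} {θ : ℝ} (hθ : ‖h'‖ ≤ θ) (u : E4) :
    |(h'.comp E4.spatial) u| ≤ θ * E4.spatialNorm u := by
  rw [ContinuousLinearMap.comp_apply, ← Real.norm_eq_abs, E4.spatialNorm]
  exact (h'.le_opNorm _).trans (mul_le_mul_of_nonneg_right hθ (norm_nonneg _))

end Shear

/-! ## The exact components `G y = g_{M,a}(S y)(DS ·, DS ·)` -/

section Components

variable {M a : ℝ} {h : E3 → ℝ} {S : E4 → E4} {G : E4 → E4 →L[ℝ] E4 →L[ℝ] ℝ}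
  (hS : ∀ y, S y = y + h (E4.spatial y) • E4.basisVector 0)
  (hG : ∀ y, G y = (Kerr.bilin M a (S y)).bilinearComp (fderiv ℝ S y) (fderiv ℝ S y))
include hS hG

/-- **The exact components in Kerr–Schild terms**: `G y (u, v) = g_{M,a}(y)(DS_y u, DS_y v)` —
the Kerr–Schild components are invariant under the time shift `S y = y + h(y⃗) e₀`
(Kerr–Schild 1965, §2). [cite: KerrSchild1965, §2] -/
theorem components_apply (y u v : E4) :
    G y u v = Kerr.bilin M a y (fderiv ℝ S y u) (fderiv ℝ S y v) := by
  rw [hG, ContinuousLinearMap.bilinearComp_apply, hS y, Kerr.bilin_add_smul_basisVector_zero]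

/-- The exact components are symmetric (so is the Kerr–Schild form). [cite: KerrSchild1965, §2] -/
theorem components_symm (y u v : E4) : G y u v = G y v u := by
  rw [components_apply hS hG, components_apply hS hG, Kerr.bilin_symm]

omit hG in
/-- The shear commutes with time translations: `S (y + t e₀) = S y + t e₀`. [folklore] -/
theorem shear_add_smul (y : E4) (t : ℝ) :
    S (y + t • E4.basisVector 0) = S y + t • E4.basisVector 0 := by
  rw [hS, hS y, Kerr.spatial_add_smul_basisVector_zero]
  abel

omit hG in
/-- Hence its differential is stationary: `DS_{y + t e₀} = DS_y` (no differentiability needed: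
both sides are Mathlib's `fderiv`, transported along the translation). [folklore] -/
theorem fderiv_shear_add_smul (y : E4) (t : ℝ) :
    fderiv ℝ S (y + t • E4.basisVector 0) = fderiv ℝ S y := by
  have h1 : (fun z ↦ S (z + t • E4.basisVector 0)) = fun z ↦ S z + t • E4.basisVector 0 :=
    funext fun z ↦ shear_add_smul hS z t
  rw [← fderiv_comp_add_right, h1, fderiv_add_const]

/-- **Stationarity of the exact components**: `G (y + t e₀) = G y` (`∂₀` is a Killing field of
the exact Kerr end in the `(t_BL-type, x_KS)` chart). [cite: KerrSchild1965, §2] -/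
theorem components_add_smul (y : E4) (t : ℝ) : G (y + t • E4.basisVector 0) = G y := by
  rw [hG, hG y, fderiv_shear_add_smul hS, shear_add_smul hS, Kerr.bilin_add_smul_basisVector_zero]

/-- **`∂₀ G = 0`**: the derivative of the components in the direction `e₀` vanishes everywhere
(at points of differentiability it is the line derivative of a constant function; elsewhere
Mathlib's `fderiv` is `0`). [cite: KerrSchild1965, §2] -/
theorem fderiv_components_basisVector_zero (y : E4) : fderiv ℝ G y (E4.basisVector 0) = 0 := by
  by_cases hd : DifferentiableAt ℝ G y
  · have h1 : HasLineDerivAt ℝ G (fderiv ℝ G y (E4.basisVector 0)) y (E4.basisVector 0) :=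
      hd.hasFDerivAt.hasLineDerivAt _
    have h2 : HasLineDerivAt ℝ G 0 y (E4.basisVector 0) := by
      have : (fun t : ℝ ↦ G (y + t • E4.basisVector 0)) = fun _ ↦ G y :=
        funext fun t ↦ components_add_smul hS hG y t
      show HasDerivAt (fun t : ℝ ↦ G (y + t • E4.basisVector 0)) 0 0
      rw [this]
      exact hasDerivAt_const (0 : ℝ) (G y)
    exact h1.unique h2
  · simp [fderiv_zero_of_not_differentiableAt hd]

/-- **Smoothness of the exact components** at a point with `r > 0` near which the height is `C^∞`:
`G = (g_{M,a} ∘ S)(DS ·, DS ·)` with `g_{M,a}` real-analytic off the ring (`Kerr.contDiffAt_bilin`)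
and `S`, `DS` smooth. [cite: KerrSchild1965, §3] -/
theorem contDiffAt_components {y : E4} (hr : 0 < Kerr.radius a y)
    (hh : ContDiffAt ℝ ∞ h (E4.spatial y)) {n : ℕ∞} : ContDiffAt ℝ n G y := by
  have hSdef : S = fun y ↦ y + h (E4.spatial y) • E4.basisVector 0 := funext hS
  have hSs : ContDiffAt ℝ ∞ S y := by
    rw [hSdef]
    exact contDiffAt_id.add ((hh.comp y E4.spatial.contDiff.contDiffAt).smul contDiffAt_const)
  have hSy : Kerr.radius a (S y) = Kerr.radius a y := by
    rw [hS, Kerr.radius_add_time_smul_basisVector]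
  have hK : ContDiffAt ℝ ∞ (fun y ↦ Kerr.bilin M a (S y)) y :=
    (Kerr.contDiffAt_bilin M a (by rw [hSy]; exact hr)).comp y hSs
  have hDS : ContDiffAt ℝ ∞ (fderiv ℝ S) y := hSs.fderiv_right (m := ∞) (by norm_num)
  have hGdef : G = fun y ↦ (Kerr.bilin M a (S y)).bilinearComp (fderiv ℝ S y) (fderiv ℝ S y) :=
    funext hG
  rw [hGdef]
  exact ((contDiffWithinAt_bilinearComp_self (s := univ) hK.contDiffWithinAt
    hDS.contDiffWithinAt).contDiffAt univ_mem).of_le (by exact_mod_cast le_top)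

/-- **Nondegeneracy of the exact components** wherever `r > 0` and `h` is differentiable: `DS_y` is
a linear bijection (`shearCLM_injective`/`_surjective`) and `g_{M,a}(y)` is nondegenerate
(`Kerr.bilin_nondegenerate`). [cite: KerrSchild1965, §2] -/
theorem components_nondegenerate {y : E4} (hr : 0 < Kerr.radius a y)
    (hh : DifferentiableAt ℝ h (E4.spatial y)) (u : E4) (hu : ∀ v, G y u v = 0) : u = 0 := by
  have hD := (hasFDerivAt_shear (y := y) hh.hasFDerivAt)
  have hSdef : S = fun y ↦ y + h (E4.spatial y) • E4.basisVector 0 := funext hS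
  have hfd : fderiv ℝ S y = ContinuousLinearMap.id ℝ E4 +
      ((fderiv ℝ h (E4.spatial y)).comp E4.spatial).smulRight (E4.basisVector 0) := by
    rw [hSdef]; exact hD.fderiv
  have hℓ := comp_spatial_basisVector_zero (fderiv ℝ h (E4.spatial y))
  have h1 : fderiv ℝ S y u = 0 := by
    refine Kerr.bilin_nondegenerate M a hr _ fun w ↦ ?_
    obtain ⟨v, rfl⟩ := (hfd ▸ shearCLM_surjective hℓ) w
    rw [← components_apply hS hG]
    exact hu v
  rw [hfd] at h1
  exact shearCLM_injective hℓ (by rw [h1, map_zero])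

/-- **`e₀` is timelike for the exact components**: `G y (e₀, e₀) = g_{M,a}(y)(e₀, e₀) = −1 + 2H(y)`,
negative as soon as `H(y) < 1/2` (in particular far out). [cite: arXiv07060622, (32)–(33)] -/
theorem components_basisVector_zero {y : E4} (hh : DifferentiableAt ℝ h (E4.spatial y)) :
    G y (E4.basisVector 0) (E4.basisVector 0) = -1 + 2 * Kerr.scalarH M a y := by
  have hSdef : S = fun y ↦ y + h (E4.spatial y) • E4.basisVector 0 := funext hS
  have hfd : fderiv ℝ S y = ContinuousLinearMap.id ℝ E4 +
      ((fderiv ℝ h (E4.spatial y)).comp E4.spatial).smulRight (E4.basisVector 0) := by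
    rw [hSdef]; exact (hasFDerivAt_shear (y := y) hh.hasFDerivAt).fderiv
  rw [components_apply hS hG, hfd, shearCLM_basisVector_zero (comp_spatial_basisVector_zero _),
    Kerr.bilin_apply, Kerr.nullCovector_basisVector_zero, Minkowski.bilin_basisVector_zero]
  ring

end Components

/-! ## Far-zone numerics -/

section Numerics

variable {M a : ℝ}

/-- **The far zone in numbers.** At a point of Kerr–Schild space with `‖x‖ ≥ 16M + |a| + 1`
(`0 ≤ M`, `|a| ≤ M`) the Kerr–Schild radius `r = r(a, (0, x))` satisfies `16M + 1 ≤ r`, and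
consequently `0 < r`, `8M < r`, `H ≤ 1/16` at every point over `x`, and the slope budget
`(2M/(r − 2M))(1 + |a|/r) ≤ 1/6` (`r² ≥ ‖x‖² − a²`, `H ≤ M/r`). [folklore] -/
theorem far_numerics (hM : 0 ≤ M) (ha : |a| ≤ M) {x : E3} (hx : 16 * M + |a| + 1 ≤ ‖x‖) :
    16 * M + 1 ≤ Kerr.radius a (E4.ofTimeSpace 0 x) ∧ 0 < Kerr.radius a (E4.ofTimeSpace 0 x) ∧
      8 * M < Kerr.radius a (E4.ofTimeSpace 0 x) ∧
      (∀ t : ℝ, Kerr.scalarH M a (E4.ofTimeSpace t x) ≤ 1 / 16) ∧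
      2 * M / (Kerr.radius a (E4.ofTimeSpace 0 x) - 2 * M) *
        (1 + |a| / Kerr.radius a (E4.ofTimeSpace 0 x)) ≤ 1 / 6 := by
  set r := Kerr.radius a (E4.ofTimeSpace 0 x) with hr_def
  have hr0' : 0 ≤ r := Kerr.radius_nonneg _ _
  have h1 := Kerr.spatialNorm_sq_sub_sq_le_radius_sq a (E4.ofTimeSpace 0 x)
  rw [E4.spatialNorm_ofTimeSpace] at h1
  have habs : 0 ≤ |a| := abs_nonneg a
  have hsq : (16 * M + 1) ^ 2 ≤ r ^ 2 := by nlinarith [sq_abs a]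
  have hr16 : 16 * M + 1 ≤ r := (abs_le_of_sq_le_sq' hsq hr0').2
  have hr0 : 0 < r := by linarith
  have hr8 : 8 * M < r := by linarith
  refine ⟨hr16, hr0, hr8, fun t ↦ ?_, ?_⟩
  · have hrt : Kerr.radius a (E4.ofTimeSpace t x) = r := Kerr.radius_ofTimeSpace a t x
    have hH := Kerr.scalarH_le_div hM a (x := E4.ofTimeSpace t x) (by rw [hrt]; exact hr0)
    rw [hrt] at hH
    refine hH.trans ?_
    rw [div_le_iff₀ hr0]
    linarith
  · have h2 : 2 * M / (r - 2 * M) ≤ 1 / 7 := by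
      rw [div_le_iff₀ (by linarith)]
      linarith
    have h3 : |a| / r ≤ 1 / 16 := by
      rw [div_le_iff₀ hr0]
      linarith
    calc 2 * M / (r - 2 * M) * (1 + |a| / r) ≤ 1 / 7 * (1 + 1 / 16) := by
          apply mul_le_mul h2 (by linarith) (by positivity) (by norm_num)
      _ ≤ 1 / 6 := by norm_num

/-- The far zone in numbers, read at a point `y ∈ E4` with `‖y⃗‖ ≥ 16M + |a| + 1`: positivity of
the radius, `H(y) ≤ 1/16`, and the slope bound `‖d(bentHeightFun)_{y⃗}‖ ≤ 1/6`. [folklore] -/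
theorem far_numerics' (hM : 0 ≤ M) (ha : |a| ≤ M) {y : E4} (hy : 16 * M + |a| + 1 ≤ E4.spatialNorm y) :
    0 < Kerr.radius a y ∧ Kerr.scalarH M a y ≤ 1 / 16 ∧
      ‖fderiv ℝ (bentHeightFun M a) (E4.spatial y)‖ ≤ 1 / 6 := by
  obtain ⟨-, hr0, hr8, hH, hθ⟩ := far_numerics hM ha (x := E4.spatial y) hy
  have hry : Kerr.radius a y = Kerr.radius a (E4.ofTimeSpace 0 (E4.spatial y)) :=
    (Kerr.radius_ofTimeSpace_spatial a y).symm
  refine ⟨by rw [hry]; exact hr0, ?_, (norm_fderiv_bentHeightFun_le hM ha hr8 hr0).trans hθ⟩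
  have := hH (y 0)
  rwa [show E4.ofTimeSpace (y 0) (E4.spatial y) = y from E4.ofTimeSpace_time_spatial y] at this

/-- **Deciding theorem of this helper file (registered stub `farExit_far_numerics`)**: the far
zone in numbers, `far_numerics` with explicit binders. [folklore] -/
theorem farExit_far_numerics : ∀ (M a : ℝ) (x : E3), 0 ≤ M → |a| ≤ M → 16 * M + |a| + 1 ≤ ‖x‖ → 16 * M + 1 ≤ Kerr.radius a (E4.ofTimeSpace 0 x) ∧ 0 < Kerr.radius a (E4.ofTimeSpace 0 x) ∧ 8 * M < Kerr.radius a (E4.ofTimeSpace 0 x) ∧ (∀ t : ℝ, Kerr.scalarH M a (E4.ofTimeSpace t x) ≤ 1 / 16) ∧ 2 * M / (Kerr.radius a (E4.ofTimeSpace 0 x) - 2 * M) * (1 + |a| / Kerr.radius a (E4.ofTimeSpace 0 x)) ≤ 1 / 6 :=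
  fun _ _ _ hM ha hx ↦ far_numerics hM ha hx

end Numerics


end Summit.FinalStateConjecture.FinalStateConjecture.Theorems.StarvedNecks.OneOverDelta.FarEnd

end
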